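import Literature.MathematicalPhysics.QuantumFieldTheory.Balaban1983to89.B2Ineq335ZeroFieldConcrete
import Literature.MathematicalPhysics.QuantumFieldTheory.Balaban1983to89.B2Ineq330RegularFieldConcrete

/-!
# `Balaban1983to89.B2Ineq335RegularFieldConcrete` — [Balaban1982Higgs2] §3.B pp. 589–591: **(3.35) AT A REGULAR NON-ZERO
VECTOR FIELD `Ã^ε` ON THE CONCRETE (Higgs)₂,₃ CARRIER WITH PROPOSITION 3.1 (RESTRICTED CLAUSE) DISCHARGED** (file 1/2; file 2/2
`B2Ineq339RegularFieldConcrete` knits (3.36)–(3.39)) — the schematic «(3.22) ⇒ (3.35)» theorem `B2Ineq335Printed.ineq335` (this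
seat, gen 6) instantiated with the (3.25) density `Z(Ã^ε)e^{−½⟨Φ,Δ(Ã^ε)Φ⟩}` of the concrete (3.23)/(3.24) carrier at a GENERAL
`Ã^ε` (`B2Eq325ConcreteSchur`, gen 4), its Proposition 3.1 input supplied by p23's `B2Ineq329RegularField.prop31_regular_concrete`
(gen 9: the restricted clause, for `Ã^ε` `δ_k`-regular on `Bᵏ(Λ_k)` and configurations obeying the sup-restrictions `|φ_k| ≤ Ψ_k`
on `Λ_k`, WITH its printed error `Σ_{k=1}^{K} O(·)|Λ_k|`): (3.22) ⇒ (3.35) at a regular `Ã^ε ≠ 0` with NO (3.26) hypothesis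
left — the companion of gen 6's zero-field file `B2Ineq335ZeroFieldConcrete`

statement-level skeleton of published theorems with citation tags; proofs where landed; nothing here is a claim about the Yang–Mills mass gap

CITATION HEADER.  T. Bałaban, *(Higgs)₂,₃ quantum fields in a finite volume. II. An upper bound*, Commun. Math. Phys.
**86** (1982) 555–594 [Balaban1982Higgs2] (cell paper B2; PDF held `paper:balaban1982-cmp86-higgs23-ii`, journal page =
PDF page + 554; pp. 586–591 re-read this gen on the text layer `p0032.txt`–`p0037.txt` and, in gens 4/6, AS IMAGES on the ×2
renders `run/shared/lean/pub/pub-balaban/b2b-balaban-ref1/pages/1982-cmp86-higgs23-II/1982-cmp86-higgs23-II-p032-x2.png` …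
`-p037-x2.png`).  Unit `lit-balaban-p15` gen 7 (Phase-2 proof seat p15; HOME `run/shared/lean/pub/lit-balaban/`).  SKELETON rows
**B2.Eq3.32** ((3.30)–(3.41), members (3.35), (3.39); fold owner r02, second reader r14, referee ref-4) and **B2.Prop3.1**
(restricted clause p. 589).  USED BY NAME (nothing restated): gen 6's `B2Ineq335Printed.ineq335`, `B2Ineq335Exceptions.rhs322`,
`B2Ineq335ZeroFieldConcrete.{KSite, Sites, cfgOf, measurePreserving_cfgOf, Bnd, bondSet, bondTerm, massTerm, massTerm_nonneg,
measurable_form325, integrable_weight4, lintegral_weight4_eq}` (the kept variables as one field, the level bookkeeping, the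
general-`Ã` measurability/integrability of the (3.25) weight), r14's `B2Eq337LastIntegrations.gaussLevel`; gen 4's
`B2Eq337ScalarIntegration.{Regions, Cfg, F325}`, `B2Eq325ConcreteSchur.{form325, Z325, eq325_concrete, Z325_pos}`,
`B2Eq328ConcretePieces.{Nested, outF, bond0, mass0, resL, pieceF, bond0_eq_sum}`, `B2Eq328DeltaK.extL`,
`B2Prop31ZeroFieldConcrete.massK`; p23's `B2Ineq329RegularField.{prop31_regular_concrete, covBondSummand_eq, gamma0_regular_spec}`, p33's `B2Eq255Concrete.{barA,
barA_zero, barA_zero_level}`, `B2Ineq329CovariantAveraging.U_mesh_barA`; SIBLING (same inputs, (3.30)/(3.31) one configuration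
at a time): p23's `B2Ineq330RegularFieldConcrete.{ineq330_regular_concrete, ineq331_regular_concrete}`.

THE SOURCE TEXT (verbatim).  Prop. 3.1 p. 589: *"There exists a constant γ₀ > 0 … such that for arbitrary configurations
Ã^ε, Φ defined by the formulas (3.2), (3.3), (3.24), and satisfying the restrictions given by the characteristic functions in
(3.21), the following inequality holds ⟨Φ, Δ(Ã^ε)Φ⟩ ≧ γ₀Σ_{k=0}^{K}Σ_{⟨x,x′⟩⊂Λ₅⁽ᵏ⁻¹⁾′∩Λ₅⁽ᵏ⁾ᶜ}(Lᵏε)^{d−2}|U(Ã^ε(⟨x,x′⟩))φ_k(x′)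
− φ_k(x)|² + γ₀Σ_{k=0}^{K}Σ_{x∈Λ₅⁽ᵏ⁻¹⁾′∩Λ₅⁽ᵏ⁾ᶜ}(Lᵏε)^d m²|φ_k(x)|² − Σ_{k=1}^{K}O((Lᵏε)^{κ₀})|(Λ₅⁽ᵏ⁻¹⁾′∩Λ₅⁽ᵏ⁾ᶜ)₁|, (3.26) with
κ₀ > 0."*  p. 586 (the restrictions on the kept fields): *"Because the fields A_k, φ_l considered on the subset Λ₅⁽ˡ⁻¹⁾′∩Λ₅⁽ˡ⁾ᶜ
… satisfy the inequalities (3.15), so we have |Φ′(x)| ≦ O(1)…p(Lᵏε)… (3.16) … Of course the above estimates are very rough"*.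
(3.30) p. 590: *"We use Proposition 3.1 and we obtain Z(Ã^ε)exp(−½⟨Φ, Δ(Ã^ε)Φ⟩) ≦ Z(Ã^ε)exp(−¼⟨Φ, Δ(Ã^ε)Φ⟩)·exp(−¼(the
right side of (3.26)))."*  (3.31) p. 590: *"… χᶜ_{Q_s⁽ᵏ⁾} exp(−¼(kᵗʰ term of the right side of (3.26))) ≦ exp(−¼γ₀p(Lᵏε)²|Q_s⁽ᵏ⁾|
+ O((Lᵏε)^{κ₀})|Λ_k|)."*  (3.35) p. 591: *"(the right side of (3.22)) ≦ ∫dΦ Z(Ã^ε)·exp(−¼⟨Φ, Δ(Ã^ε)Φ⟩) Π_{k=0}^{K−1} ζ′_{Λ₀⁽ᵏ⁾}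
· exp Σ_{k=1}^{K} O((Lᵏε)^{κ₀})|Λ_k|."*  (3.39) p. 591: *"(the expression {…} on the left side of (3.22)) ≦ Π_{k=0}^{K−1} ζ′_{Λ₀⁽ᵏ⁾}
exp(E_{0,s}) exp(O(1) Σ_{k=0}^{K}|Λ_k|)."*  ((3.32)–(3.34) are quoted in `B2Ineq335Exceptions`; (3.36)–(3.38) in
`B2Ineq339Gathering`.)

THE MODEL (as in the zero-field file, with `Ã^ε` general).  Level 0 of the schematic chain of `B2Ineq335Exceptions` is the
CONCRETE configuration space of (3.24) (fields on `KSite R = Λ₅⁽⁰⁾ᶜ ⊔ ⨆_{k=1}^{K}Λ_k`, transported to gen 4's `Cfg R N` by the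
volume-preserving `cfgOf`); the levels `n+1` are schematic output sites with r14's Gaussian kernels `gaussLevel` (precision `a·s_n`,
history-dependent measurable centres `c_n` ↤ `Q(Ã^ε)φ_n`), the printed large-field indicators at the exceptional sites `P_s⁽ⁿ⁾`
(`largeFieldSite`), the other characteristic functions `b ∈ [0,1]`, family weights `w`.  CONCRETE are: the weight
`Z(Ã^ε)e^{−½⟨Φ,Δ(Ã^ε)Φ⟩}` with `⟨Φ,Δ(Ã^ε)Φ⟩ = form325 R C a Ã m²`, `Z(Ã^ε) = Z325 R C a Ã m²` (`= F325`, `weight_eq_F325_field`);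
the k-th term of (3.26) at `Ã^ε`: its bonds `bondSet R k` (gen 6), its COVARIANT bond terms `bondTermA` —
`(Lᵏε)^d|(D^{Lᵏε}_{Ā⁽ᵏ⁾}φ̃_k)(⟨y,y′⟩)|² = (Lᵏε)^{d−2}|U(Ã^ε(⟨y,y′⟩))φ_k(y′) − φ_k(y)|²` with the coarse transport
`U(Ã^ε(⟨y,y′⟩)) = U(ε, Σ_{straight}Ã) = U(Lᵏε, Ā⁽ᵏ⁾(⟨y,y′⟩))` ((II.2.55), p33's `barA`; `bondTermA_succ_eq_printed`; `k = 0`: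
`barA 0 Ã = Ã`), its mass part `massTerm` (gen 6), the error `errTerm k = 64γ₀d³e²(Lᵏδ_k)²Ψ_k²(Lᵏε)^d|Λ_k|` (`k ≥ 1`; `0` at
`k = 0`) of p23's restricted Prop. 3.1.  «satisfying the restrictions given by the characteristic functions in (3.21)» is read,
as in p23's files, as: `Ã^ε` is `δ_k`-regular on `Bᵏ(Λ_k)` (a hypothesis on the fixed external field `Ã^ε` of the scalar
integration, p. 588 *"treating the configuration Ã^ε as a fixed external field"*) and the kept configuration obeys `|φ_k| ≤ Ψ_k`
on `Λ_k` ON THE SUPPORT OF THE OTHER CHARACTERISTIC FUNCTIONS `b` (hypothesis `hrestr`: `b ≠ 0 ⇒` the sup-restrictions; these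
are the small-field conditions (3.15)/(3.16) p. 586 carried by (3.21)); the bond restrictions `χᶜ_{Q_s⁽ʲ⁾}` read the concrete
covariant bond terms (`hlarge`).

WHAT IS PROVED (kernel-checked, 0 `sorry`, standard axioms).
§1 `bondTermA` (def), `bondTermA_nonneg`, `bondTermA_zeroField` (= gen 6's `bondTerm` at `Ã^ε = 0`), `bondTermA_zero_eq_printed` /
   `bondTermA_succ_eq_printed` (the printed `(Lᵏε)^{d−2}|U(Ã(⟨y,y′⟩))φ_k(y′) − φ_k(y)|²`), `sum_bondSetA_zero` (= `bond0 R C Ã`),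
   `sum_bondSetA_succ` (= p23's covariant k-th bond sum), `errTerm` (def), `errTerm_nonneg`, `sum_errTerm`, `sum_levels_eq_field`,
   **`h326_regular`** (the right side of (3.26) at `Ã^ε`, summed over `k ≤ K`, errors included, is `≤ form325(Φ)` for every
   RESTRICTED `Φ`: `prop31_regular_concrete`), `weight_eq_F325_field`.
§2 **`ineq335_regular`**: `(3.22) ≤ e^{¼Σ_{k=1}^{K}E_k} · ∫dΦ Z(Ã)e^{−¼⟨Φ,Δ(Ã)Φ⟩} · Π_{j<K}Σ_τ w_{j,τ}e^{−¼γ₀r_j|Q_s⁽ʲ⁾(τ)|}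
   (e^{−⅛ar_j})^{|P_s⁽ʲ⁾(τ)|}` — (3.35) WITH its printed error factor, for nested region data (`K ≤` the number of scales,
   `Lᴷε ≤ 1`), `m² > 0`, `a > 0`, `L > 1`, any admissible `γ₀` (`0 ≤ γ₀ ≤ 1/16`, `γ₀(8d + 2m² + 4) ≤ a(1 − L⁻²)`; one positive
   such constant is p23's `gamma0_regular_spec`), from `hreg`/`hsmall` (regularity of `Ã`), `hrestr`, `hlarge`, `4N log 2 ≤ a r_j`.
(File 2/2 `B2Ineq339RegularFieldConcrete`: the knit (3.35) ⇒ (3.39) at `Ã^ε`, explicit and printed error shapes.)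
HONEST SCOPE.  (i) The regularity moduli `δ_k`, the sup-bounds `Ψ_k` and the smallness `8d⁴L^d e²(Lᵏε)²(Lᵏδ_k)² ≤ ½` are
HYPOTHESES in p23's explicit reading of *"the restrictions given by the characteristic functions in (3.21)"*; that (3.21)'s
characteristic functions ((3.2)/(3.3), (3.15)/(3.16)) deliver them with `64γ₀d³e²(Lᵏδ_k)²Ψ_k²(Lᵏε)^d = O((Lᵏε)^{κ₀})` is NOT
proved here (rows B2.Eq3.21/3.31; G-pv07-1 (ii)).  (ii) The OUTPUT structure stays schematic exactly as in gen 6 (output sites,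
centres, exceptional sites, families, weights are data; the (3.21) → (3.22) composition is not constructed); what is concrete is
everything Proposition 3.1 talks about, now at `Ã^ε ≠ 0`.  (iii) The print writes the error factor of (3.35) as `exp Σ O((Lᵏε)^{κ₀})|Λ_k|` without the factor ¼ of (3.30); we keep
`¼` (sharper).  Value = the published §3.B estimate (3.35) closed at a regular external field on the concrete carrier; NOT
summit progress.
-/

noncomputable section

open MeasureTheory Finset Function Real
open scoped ENNReal BigOperators

namespace Literature.MathematicalPhysics.QuantumFieldTheory.Balaban1983to89.B2Ineq335RegularFieldConcrete

open Literature.MathematicalPhysics.QuantumFieldTheory.Balaban1983to89.HiggsLattice (covDeriv ChargeData)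
open Literature.MathematicalPhysics.QuantumFieldTheory.Balaban1983to89.HiggsAveraging (segSum toFinest)
open Literature.MathematicalPhysics.QuantumFieldTheory.Balaban1983to89.HiggsCovariancePos (Inside)
open Literature.MathematicalPhysics.QuantumFieldTheory.Balaban1983to89.B2Eq337ScalarIntegration
open Literature.MathematicalPhysics.QuantumFieldTheory.Balaban1983to89.B2Eq325ConcreteSchur
open Literature.MathematicalPhysics.QuantumFieldTheory.Balaban1983to89.B2Eq328ConcretePieces
open Literature.MathematicalPhysics.QuantumFieldTheory.Balaban1983to89.B2Eq328DeltaK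
open Literature.MathematicalPhysics.QuantumFieldTheory.Balaban1983to89.B2Prop31ZeroFieldConcrete
open Literature.MathematicalPhysics.QuantumFieldTheory.Balaban1983to89.B2Eq337LastIntegrations
open Literature.MathematicalPhysics.QuantumFieldTheory.Balaban1983to89.B2Ineq335Exceptions
open Literature.MathematicalPhysics.QuantumFieldTheory.Balaban1983to89.B2Ineq335Printed
open Literature.MathematicalPhysics.QuantumFieldTheory.Balaban1983to89.B2Ineq335ZeroFieldConcrete
open Literature.MathematicalPhysics.QuantumFieldTheory.Balaban1983to89.B2Eq255Concrete (barA barA_zero barA_zero_level)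
open Literature.MathematicalPhysics.QuantumFieldTheory.Balaban1983to89.B2Ineq329CovariantAveraging (U_mesh_barA)
open Literature.MathematicalPhysics.QuantumFieldTheory.Balaban1983to89.B2Ineq329RegularField

variable {P : HiggsLattice.Params} {N K : ℕ}

/-! ## §1  The restricted Proposition 3.1 data of the concrete carrier at `Ã^ε`, in the letters of `B2Ineq335Printed.ineq335` -/

section Data

variable (R : Regions P K) (C : HiggsLattice.ChargeData N) (A : HiggsLattice.VecField P 0) (a msq : ℝ)

/-- The COVARIANT bond terms of (3.26) at `Ã^ε`: `(Lᵏε)^d|(D^{Lᵏε}_{Ā⁽ᵏ⁾}φ̃_k)(b)|²` with the coarse bond variable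
`Lᵏε·Ā⁽ᵏ⁾ = ε·Σ_{straight}Ã` (`barA k Ã`; `k = 0`: `Ã` itself), read on the kept variables (`φ₀` re-glued with `0` on `Λ₅⁽⁰⁾` —
irrelevant on the bonds inside `Λ₅⁽⁰⁾ᶜ`; `φ_k` extended by `0` off `Λ_k` — irrelevant on the bonds inside `Λ_k`).
[cite: Balaban1982Higgs2, Prop. 3.1 (3.26) p.589] [cite: Balaban1982Higgs2, (2.55) p.569] -/
def bondTermA (u : KSite R → V N) : Bnd P → ℝ
  | ⟨0, c⟩ => P.mesh 0 ^ P.d * ‖covDeriv C A (field R (cfgOf R u).1 (0 : InCfg R N)) c‖ ^ 2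
  | ⟨k + 1, c⟩ =>
    if h : k < K then
      P.mesh (k + 1) ^ P.d * ‖covDeriv C (barA (k + 1) A) (extL R ⟨k, h⟩ (resL R ⟨k, h⟩ (cfgOf R u))) c‖ ^ 2
    else 0

/-- The error terms of the restricted Proposition 3.1 (p23's `prop31_regular_concrete`), per level: none at `k = 0`,
`64γ₀d³e²(Lᵏδ_k)²·Ψ_k²(Lᵏε)^d|Λ_k|` at `k = 1, …, K` — the printed `O((Lᵏε)^{κ₀})|(Λ₅⁽ᵏ⁻¹⁾′∩Λ₅⁽ᵏ⁾ᶜ)₁|` in p23's explicit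
reading. [cite: Balaban1982Higgs2, Prop. 3.1 (3.26) p.589] [cite: Balaban1983RegularityDecay, (1.22) p.574] -/
def errTerm (γ₀ : ℝ) (δ Ψ : Fin K → ℝ) : ℕ → ℝ
  | 0 => 0
  | k + 1 =>
    if h : k < K then
      64 * γ₀ * (P.d : ℝ) ^ 3 * C.e ^ 2 * ((P.L : ℝ) ^ (k + 1)) ^ 2 * δ ⟨k, h⟩ ^ 2 *
        (Ψ ⟨k, h⟩ ^ 2 * P.mesh (k + 1) ^ P.d * ((R.block ⟨k, h⟩).card : ℝ))
    else 0

variable {R C A a msq}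

/-- the covariant bond terms are non-negative. [cite: Balaban1982Higgs2, Prop. 3.1 (3.26) p.589] -/
theorem bondTermA_nonneg (u : KSite R → V N) (b : Bnd P) : 0 ≤ bondTermA R C A u b := by
  rcases b with ⟨_ | k, c⟩
  · exact mul_nonneg (pow_nonneg (P.mesh_pos 0).le _) (sq_nonneg _)
  · simp only [bondTermA]
    split_ifs
    · exact mul_nonneg (pow_nonneg (P.mesh_pos _).le _) (sq_nonneg _)
    · exact le_rfl

/-- At `Ã^ε = 0` the covariant bond terms are gen 6's `bondTerm` (`Ā⁽ᵏ⁾ = 0`, `D_0 = ∂`). [cite: Balaban1982Higgs2, Prop. 3.1 (3.26) p.589] -/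
theorem bondTermA_zeroField (u : KSite R → V N) (b : Bnd P) :
    bondTermA R C (0 : HiggsLattice.VecField P 0) u b = bondTerm R C u b := by
  rcases b with ⟨_ | k, c⟩
  · rfl
  · simp only [bondTermA, bondTerm]
    split_ifs
    · rw [barA_zero, HiggsLattice.covDeriv_zero]
    · rfl

/-- The level-0 covariant bond term in the printed letters: `ε^d|(D^ε_{Ã}φ₀)(⟨x,x′⟩)|² = ε^{d−2}|U(Ã(⟨x,x′⟩))φ₀(x′) − φ₀(x)|²`
(`U(Ã(b)) = U(ε, Ã_b)`). [cite: Balaban1982Higgs2, Prop. 3.1 (3.26) p.589] -/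
theorem bondTermA_zero_eq_printed (u : KSite R → V N) (c : HiggsLattice.PBond P 0) :
    bondTermA R C A u ⟨0, c⟩ = P.mesh 0 ^ P.d * (P.mesh 0)⁻¹ ^ 2 *
      ‖C.U (P.mesh 0) (A c) (field R (cfgOf R u).1 (0 : InCfg R N) c.tgt)
        - field R (cfgOf R u).1 (0 : InCfg R N) c.src‖ ^ 2 := by
  simp only [bondTermA]
  exact covBondSummand_eq C A _ c

/-- The level-`k` (`k = j+1 ≤ K`) covariant bond term in the printed letters:
`(Lᵏε)^{d−2}|U(Ã^ε(⟨y,y′⟩))φ_k(y′) − φ_k(y)|²` with the coarse transport `U(Ã^ε(⟨y,y′⟩)) = U(ε, Σ_{⟨x,x′⟩⊂⟨y,y′⟩}Ã_{⟨x,x′⟩})`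
((II.2.55); p23's `U_mesh_barA`) — the quantity restricted by `χᶜ_{Q_s⁽ᵏ⁾}` on p. 590. [cite: Balaban1982Higgs2, (3.31) p.590]
[cite: Balaban1982Higgs2, (2.55) p.569] -/
theorem bondTermA_succ_eq_printed (u : KSite R → V N) (j : Fin K) (c : HiggsLattice.PBond P (j.val + 1)) :
    bondTermA R C A u ⟨j.val + 1, c⟩ = P.mesh (j.val + 1) ^ P.d * (P.mesh (j.val + 1))⁻¹ ^ 2 *
      ‖C.U (P.mesh 0) (segSum A (toFinest c.src) c.dir (P.L ^ (j.val + 1)))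
          (extL R j (resL R j (cfgOf R u)) c.tgt) - extL R j (resL R j (cfgOf R u)) c.src‖ ^ 2 := by
  simp only [bondTermA, dif_pos j.isLt]
  rw [covBondSummand_eq, U_mesh_barA]

/-- the level-0 covariant bond sum is `bond0 R C Ã` (`bond0_eq_sum`). [cite: Balaban1982Higgs2, Prop. 3.1 (3.26) p.589] -/
theorem sum_bondSetA_zero (u : KSite R → V N) :
    ∑ b ∈ bondSet R 0, bondTermA R C A u b = bond0 R C A (cfgOf R u).1 := by
  have hB : bondSet R 0
      = (Finset.univ.filter fun c : HiggsLattice.PBond P 0 => Inside (outF R) c).map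
          (Function.Embedding.sigmaMk (β := fun k => HiggsLattice.PBond P k) 0) := rfl
  rw [hB, Finset.sum_map, Finset.sum_filter, bond0_eq_sum]
  refine Finset.sum_congr rfl fun c _ => ?_
  simp only [Function.Embedding.sigmaMk_apply, bondTermA]

/-- the level-(j+1) covariant bond sum is p23's `Σ_{c⊂Λ_{j+1}}(Lʲ⁺¹ε)^d|(D_{Ā⁽ʲ⁺¹⁾}φ̃_{j+1})(c)|²`.
[cite: Balaban1982Higgs2, Prop. 3.1 (3.26) p.589] -/
theorem sum_bondSetA_succ (u : KSite R → V N) (j : Fin K) :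
    ∑ b ∈ bondSet R (j.val + 1), bondTermA R C A u b
      = ∑ c : HiggsLattice.PBond P (j.val + 1), if Inside (R.block j) c then
          P.mesh (j.val + 1) ^ P.d * ‖covDeriv C (barA (j.val + 1) A) (extL R j (resL R j (cfgOf R u))) c‖ ^ 2 else 0 := by
  have hB : bondSet R (j.val + 1)
      = (Finset.univ.filter fun c : HiggsLattice.PBond P (j.val + 1) => Inside (R.block j) c).map
          (Function.Embedding.sigmaMk (β := fun k => HiggsLattice.PBond P k) (j.val + 1)) := by
    simp only [bondSet, dif_pos j.isLt]
  rw [hB, Finset.sum_map, Finset.sum_filter]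
  refine Finset.sum_congr rfl fun c _ => ?_
  simp only [Function.Embedding.sigmaMk_apply, bondTermA, dif_pos j.isLt]

/-- the error terms are non-negative for `γ₀ ≥ 0`. [cite: Balaban1982Higgs2, Prop. 3.1 (3.26) p.589] -/
theorem errTerm_nonneg {γ₀ : ℝ} (hγ0 : 0 ≤ γ₀) (δ Ψ : Fin K → ℝ) (n : ℕ) : 0 ≤ errTerm R C γ₀ δ Ψ n := by
  rcases n with _ | k
  · exact le_rfl
  · simp only [errTerm]
    split_ifs
    · have := (P.mesh_pos (k + 1)).le
      positivity
    · exact le_rfl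

/-- `Σ_{k=0}^{K} E_k = Σ_{k=1}^{K} 64γ₀d³e²(Lᵏδ_k)²Ψ_k²(Lᵏε)^d|Λ_k|` (no error at `k = 0`). [cite: Balaban1982Higgs2, Prop. 3.1 (3.26) p.589] -/
theorem sum_errTerm (γ₀ : ℝ) (δ Ψ : Fin K → ℝ) :
    ∑ n ∈ range (K + 1), errTerm R C γ₀ δ Ψ n
      = ∑ j : Fin K, 64 * γ₀ * (P.d : ℝ) ^ 3 * C.e ^ 2 * ((P.L : ℝ) ^ (j.val + 1)) ^ 2 * δ j ^ 2 *
          (Ψ j ^ 2 * P.mesh (j.val + 1) ^ P.d * ((R.block j).card : ℝ)) := by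
  rw [Finset.sum_range_succ', ← Fin.sum_univ_eq_sum_range (fun n => errTerm R C γ₀ δ Ψ (n + 1)) K]
  have h0 : errTerm R C γ₀ δ Ψ 0 = 0 := rfl
  rw [h0, add_zero]
  refine Finset.sum_congr rfl fun j _ => ?_
  simp only [errTerm, dif_pos j.isLt]

/-- **the right side of (3.26) at `Ã^ε`, summed over the levels `k = 0, …, K`, errors included**, equals the three sums of
p23's `B2Ineq329RegularField.prop31_regular_concrete`. [cite: Balaban1982Higgs2, Prop. 3.1 (3.26) p.589] -/
theorem sum_levels_eq_field (γ₀ : ℝ) (δ Ψ : Fin K → ℝ) (u : KSite R → V N) :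
    ∑ n ∈ range (K + 1), (γ₀ * (∑ b ∈ bondSet R n, bondTermA R C A u b + massTerm R msq u n) - errTerm R C γ₀ δ Ψ n)
      = γ₀ * (bond0 R C A (cfgOf R u).1 + ∑ j : Fin K, (∑ c : HiggsLattice.PBond P (j.val + 1),
            if Inside (R.block j) c then P.mesh (j.val + 1) ^ P.d *
              ‖covDeriv C (barA (j.val + 1) A) (extL R j (resL R j (cfgOf R u))) c‖ ^ 2 else 0))
        + γ₀ * (mass0 R msq (cfgOf R u).1 + ∑ j : Fin K, massK R msq j (resL R j (cfgOf R u)))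
        - ∑ j : Fin K, 64 * γ₀ * (P.d : ℝ) ^ 3 * C.e ^ 2 * ((P.L : ℝ) ^ (j.val + 1)) ^ 2 * δ j ^ 2 *
            (Ψ j ^ 2 * P.mesh (j.val + 1) ^ P.d * ((R.block j).card : ℝ)) := by
  rw [Finset.sum_sub_distrib, sum_errTerm]
  congr 1
  rw [Finset.sum_range_succ', ← Fin.sum_univ_eq_sum_range (fun n => γ₀ * (∑ b ∈ bondSet R (n + 1),
    bondTermA R C A u b + massTerm R msq u (n + 1))) K]
  have h1 : ∀ j : Fin K, γ₀ * (∑ b ∈ bondSet R (j.val + 1), bondTermA R C A u b + massTerm R msq u (j.val + 1))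
      = γ₀ * (∑ c : HiggsLattice.PBond P (j.val + 1), if Inside (R.block j) c then P.mesh (j.val + 1) ^ P.d *
            ‖covDeriv C (barA (j.val + 1) A) (extL R j (resL R j (cfgOf R u))) c‖ ^ 2 else 0)
        + γ₀ * massK R msq j (resL R j (cfgOf R u)) := fun j => by
    rw [sum_bondSetA_succ]
    simp only [massTerm, dif_pos j.isLt]
    ring
  have h0 : massTerm R msq u 0 = mass0 R msq (cfgOf R u).1 := rfl
  simp only [h1, h0, sum_bondSetA_zero, Finset.sum_add_distrib, ← Finset.mul_sum]
  ring

/-- **PROPOSITION 3.1, RESTRICTED CLAUSE, feeds `h326`**: for nested region data (`K ≤` the number of scales, `Lᴷε ≤ 1`),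
`m² > 0`, `a > 0`, `L > 1`, `Ã^ε` `δ_k`-regular on every `Bᵏ(Λ_k)` with the smallness `8d⁴L^d e²(Lᵏε)²(Lᵏδ_k)² ≤ ½`, an
admissible `γ₀`, and EVERY kept configuration obeying the sup-restrictions `|φ_k(y)| ≤ Ψ_k` on `Λ_k`:
`Σ_{k≤K}(γ₀(Σ_b t_{k,b} + M_k) − E_k) ≤ ⟨Φ,Δ(Ã^ε)Φ⟩ = form325(Φ)` — p23's `prop31_regular_concrete` in the level bookkeeping of
`B2Ineq335Printed.ineq335`. [cite: Balaban1982Higgs2, Prop. 3.1 (3.26) p.589] [cite: Balaban1983RegularityDecay, (1.21)–(1.22) p.574] -/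
theorem h326_regular (hR : Nested R) (hK : K ≤ P.K) (hε : P.mesh K ≤ 1) (ha : 0 < a) (hL : 1 < P.L) (hmsq : 0 < msq)
    {δ : Fin K → ℝ} (hδ : ∀ j, 0 ≤ δ j)
    (hreg : ∀ (j : Fin K), ∀ z ∈ pieceF R j, ∀ μ' ν : Fin P.d, |A ⟨z.shift ν, μ'⟩ - A ⟨z, μ'⟩| ≤ δ j)
    (hsmall : ∀ j : Fin K, 8 * (P.d : ℝ) ^ 4 * (P.L : ℝ) ^ P.d * C.e ^ 2 * P.mesh (j.val + 1) ^ 2 *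
      ((P.L : ℝ) ^ (j.val + 1)) ^ 2 * δ j ^ 2 ≤ 1 / 2)
    {γ₀ : ℝ} (hγ0 : 0 ≤ γ₀) (hγB : γ₀ * (8 * P.d + 2 * msq + 4) ≤ a * (1 - ((P.L : ℝ) ^ 2)⁻¹))
    (hγ16 : γ₀ ≤ 1 / 16) (Ψ : Fin K → ℝ) (u : KSite R → V N)
    (hΦ : ∀ (j : Fin K) (y : LSite R j), ‖resL R j (cfgOf R u) y‖ ≤ Ψ j) :
    ∑ n ∈ range (K + 1), (γ₀ * (∑ b ∈ bondSet R n, bondTermA R C A u b + massTerm R msq u n) - errTerm R C γ₀ δ Ψ n)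
      ≤ form325 R C a A msq (cfgOf R u) := by
  rw [sum_levels_eq_field]
  exact prop31_regular_concrete R C A hR hK hε ha hL hmsq hδ hreg hsmall hγ0 hγB hγ16 Ψ (cfgOf R u) hΦ

/-- DICTIONARY: the weight `F` of `rhs322` is (3.25) at `Ã^ε`: `Z(Ã)e^{−½⟨Φ,Δ(Ã)Φ⟩} = F325(Φ)` on the transported configuration.
[cite: Balaban1982Higgs2, (3.25) p.589] -/
theorem weight_eq_F325_field (ha : 0 < a) (hL : 1 < P.L) (hmsq : 0 < msq) (u : KSite R → V N) :
    ENNReal.ofReal (Z325 R C a A msq * Real.exp (-(form325 R C a A msq (cfgOf R u) / 2)))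
      = ENNReal.ofReal (F325 R C a A msq (cfgOf R u)) := by
  rw [eq325_concrete R C A ha hL hmsq (cfgOf R u),
    show -(form325 R C a A msq (cfgOf R u) / 2) = -(1 / 2 : ℝ) * form325 R C a A msq (cfgOf R u) by ring]

end Data

/-! ## §2  (3.35) AT A REGULAR `Ã^ε ≠ 0` with Proposition 3.1 (restricted clause) DISCHARGED on the concrete (3.25) carrier -/

section Ineq335Regular

variable (R : Regions P K) (C : HiggsLattice.ChargeData N) (A : HiggsLattice.VecField P 0) {a msq : ℝ}
variable {O : ℕ → Type} [∀ i, Fintype (O i)] [∀ i, DecidableEq (O i)]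
variable {ι : Fin K → Type*} [∀ j, Fintype (ι j)]

/-- **(3.35) AT A REGULAR NON-ZERO `Ã^ε`, PROPOSITION 3.1 (RESTRICTED CLAUSE) DISCHARGED**: for nested region data `R` of the
concrete (Higgs)₂,₃ carrier (`K ≤` the number of scales, `Lᴷε ≤ 1`, `m² > 0`, `a > 0`, `L > 1`), an external vector field `Ã^ε`
which is `δ_k`-regular on every `Bᵏ(Λ_k)` ((1.21) of [B4] in lattice units) with `8d⁴L^d e²(Lᵏε)²(Lᵏδ_k)² ≤ ½`, an admissible
`γ₀` (`0 ≤ γ₀ ≤ 1/16`, `γ₀(8d + 2m² + 4) ≤ a(1 − L⁻²)`), the schematic right side of (3.22) (`B2Ineq335Exceptions.rhs322`) whose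
level 0 is the space of the kept configurations `Φ` of (3.24), whose weight is (3.25) at `Ã^ε`, `Z(Ã)exp(−½⟨Φ,Δ(Ã)Φ⟩)` (= `F325`,
`weight_eq_F325_field`), whose other characteristic functions `b ∈ [0,1]` carry the sup-restrictions `|φ_k| ≤ Ψ_k` on `Λ_k`
((3.15)/(3.16): `hrestr`), whose bond restrictions `χᶜ_{Q_s⁽ʲ⁾}` concern the CONCRETE covariant bond terms
`(Lʲε)^{d−2}|U(Ã(⟨y,y′⟩))φ_j(y′) − φ_j(y)|²` of (3.26) on the bonds of `Λ_j` (`bondSet`, `bondTermA`; `hlarge`), and whose output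
structure is schematic as in `B2Ineq335Printed.ineq335`, satisfies
`(3.22) ≤ e^{¼Σ_{k=1}^{K}E_k} · ∫dΦ Z(Ã)e^{−¼⟨Φ,Δ(Ã)Φ⟩} · Π_{j<K} Σ_τ w_{j,τ}·e^{−¼γ₀r_j|Q_s⁽ʲ⁾(τ)|}·(e^{−⅛ar_j})^{|P_s⁽ʲ⁾(τ)|}`,
`E_k = 64γ₀d³e²(Lᵏδ_k)²Ψ_k²(Lᵏε)^d|Λ_k|` — the printed `exp Σ_{k=1}^{K}O((Lᵏε)^{κ₀})|Λ_k|`, the input (3.26) being p23's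
`B2Ineq329RegularField.prop31_regular_concrete`. [cite: Balaban1982Higgs2, (3.35) p.591, Prop. 3.1 (3.26) p.589] -/
theorem ineq335_regular (hR : Nested R) (hK : K ≤ P.K) (hε : P.mesh K ≤ 1) (ha : 0 < a) (hL : 1 < P.L)
    (hmsq : 0 < msq) {δ : Fin K → ℝ} (hδ : ∀ j, 0 ≤ δ j)
    (hreg : ∀ (j : Fin K), ∀ z ∈ pieceF R j, ∀ μ' ν : Fin P.d, |A ⟨z.shift ν, μ'⟩ - A ⟨z, μ'⟩| ≤ δ j)
    (hsmall : ∀ j : Fin K, 8 * (P.d : ℝ) ^ 4 * (P.L : ℝ) ^ P.d * C.e ^ 2 * P.mesh (j.val + 1) ^ 2 *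
      ((P.L : ℝ) ^ (j.val + 1)) ^ 2 * δ j ^ 2 ≤ 1 / 2)
    {γ₀ : ℝ} (hγ0 : 0 ≤ γ₀) (hγB : γ₀ * (8 * P.d + 2 * msq + 4) ≤ a * (1 - ((P.L : ℝ) ^ 2)⁻¹))
    (hγ16 : γ₀ ≤ 1 / 16) (Ψ : Fin K → ℝ) {s : ℕ → ℝ} (hs : ∀ j, 0 < s j)
    {c : (j : ℕ) → ((i : ℕ) → Sites R O i → V N) → Sites R O (j + 1) → V N} (hc : ∀ j, Measurable (c j))
    (hcdep : ∀ j i, j + 1 ≤ i → ∀ (x : (i : ℕ) → Sites R O i → V N) (y : Sites R O i → V N),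
      c j (update x i y) = c j x)
    {r : ℕ → ℝ} (hr : ∀ j, 4 * (N : ℝ) * Real.log 2 ≤ a * r j)
    {b : ((i : ℕ) → Sites R O i → V N) → ℝ} (hb : ∀ x, 0 ≤ b x ∧ b x ≤ 1)
    (hrestr : ∀ x, b x ≠ 0 → ∀ (j : Fin K) (y : LSite R j), ‖resL R j (cfgOf R (x 0)) y‖ ≤ Ψ j)
    (w : (j : Fin K) → ι j → ℝ≥0∞) (Q : (j : Fin K) → ι j → Finset (Bnd P)) (hQ : ∀ j τ, Q j τ ⊆ bondSet R j)
    (Pex : (j : Fin K) → ι j → Finset (Sites R O (j + 1)))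
    (χQ : (j : Fin K) → ι j → (KSite R → V N) → ℝ) (hχ : ∀ j τ u, χQ j τ u = 0 ∨ χQ j τ u = 1)
    (hlarge : ∀ j τ u, χQ j τ u = 1 → ∀ bb ∈ Q j τ, r j < bondTermA R C A u bb)
    (x : (i : ℕ) → Sites R O i → V N) :
    rhs322 (fun i => (volume : Measure (Sites R O i → V N)))
        (fun u => ENNReal.ofReal (Z325 R C a A msq * Real.exp (-(form325 R C a A msq (cfgOf R u) / 2))))
        (fun x => ENNReal.ofReal (b x))
        (gaussLevel (fun j _ => a * s j) c) w (fun j τ u => ENNReal.ofReal (χQ j τ u))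
        (fun j τ => excLevel c j (largeFieldSite (Pex j τ) (s j) (r j))) x
      ≤ ENNReal.ofReal (Real.exp ((∑ n ∈ range (K + 1), errTerm R C γ₀ δ Ψ n) / 4))
        * (∫⁻ u : KSite R → V N, ENNReal.ofReal (Z325 R C a A msq
            * Real.exp (-(form325 R C a A msq (cfgOf R u) / 4))))
        * ∏ j : Fin K, ∑ τ : ι j, w j τ
            * ENNReal.ofReal (Real.exp (-(γ₀ * r j * (Q j τ).card / 4)))
            * ENNReal.ofReal (Real.exp (-(a * r j / 8)) ^ (Pex j τ).card) := by
  have hr' : ∀ j, 4 * (Module.finrank ℝ (V N) : ℝ) * Real.log 2 ≤ a * r j := fun j => by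
    rw [finrank_V]; exact hr j
  have hX : Measurable (fun u : KSite R → V N => form325 R C a A msq (cfgOf R u)) :=
    (measurable_form325 (R := R) (C := C) A ha hL hmsq).comp (cfgOf R).measurable
  exact ineq335 (S := Sites R O) (ι := ι) ha hs hc hcdep hr'
    (Z325_pos R C A ha hL hmsq).le hX (bondSet R)
    (fun _ bb u => bondTermA R C A u bb) (fun _ bb _ u => bondTermA_nonneg u bb)
    (M := fun n u => massTerm R msq u n) (fun n u => massTerm_nonneg hmsq.le u n) (errTerm R C γ₀ δ Ψ)
    hγ0 hb (fun x hx => h326_regular (R := R) (C := C) (A := A) hR hK hε ha hL hmsq hδ hreg hsmall hγ0 hγB hγ16 Ψ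
      (x 0) (hrestr x hx))
    w Q hQ Pex χQ hχ hlarge x

end Ineq335Regular

end Literature.MathematicalPhysics.QuantumFieldTheory.Balaban1983to89.B2Ineq335RegularFieldConcrete

end
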